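import Summits.AnomalousDissipation.AnomalousDissipation.Theorems.SawtoothPulseCascadeK1LocalisedCascadePhaseOneStart
import Summits.AnomalousDissipation.AnomalousDissipation.Theorems.SawtoothPulseCascadeK1LocalisedCascadeExactChirpSelf
import Summits.AnomalousDissipation.AnomalousDissipation.Theorems.SawtoothPulseCascadeK1LocalisedCascadeFibreMarginals
import Summits.AnomalousDissipation.AnomalousDissipation.Theorems.SawtoothPulseCascadeK1LocalisedCascadeChirpRounding

/-!
# K1loc, line `Spectral` / thin start — helper: PHASE-TWO START BOX I — the V-fibre energies of `a₁` are EXACT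

Helper file of the prover lane on the crux `K1LocalisedCascade` (stmt-AnomalousDissipation-19491), route `SawtoothPulseCascade`
(glue seat; owner of the start box of record `StartBoxTwo`, arbiter A23-4/A23-5: `E_2(K_2 = 800) ≤ 3/100`).  The start chain is
`S_1(K″) → T_1(K′) → S_2(K_2)` (strip of `a₁` → low V-fibres of `b₁` → strip of `a₂`); this file is the `a₁`-explicit end, part I:
the energies of `a₁ = (datum ∘ Φ_H) ∘ Φ_V` (profile `ψ`, any rounding) on its V-fibres `{k₁ = q}` are EXACT —
**`Σ' k, w(k₁)‖𝓕a₁(k)‖² = ¼·Σ'_q w(q)(‖ĝ₁(q)‖² + ‖ĝ₋₁(q)‖²)`** (`tsum_fibreWeight_sq_norm_phaseOne_eq`; `ĝ_n = 𝓕(twist ψ n)`):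
the V half-step preserves every V-fibre's energy (`…FibreMarginals.tsum_verticalWeight_vstep`) and `b₀ = datum ∘ Φ_H` has exactly
the two H-modes `k₀ = ±1` (`…PhaseOneModes.mFourierCoeff_datum_comp_shearMap`).  No `(u+v)² ≤ 2(u²+v²)` loss — the road of
`…PhaseOneStart` over-counts the dominant fibres `q = ±1` by the factor `2`.  Consequences at `γ = 8` with the exact weight table of
`…ExactChirpSelf` and single-coefficient rounding (`norm_fourierCoeff_twist_le_of_near`):
* `tsum_fibre_sq_norm_phaseOne_le`: `Σ'[k₁ = q]‖𝓕a₁‖² ≤ ½(√w(|q|) + 2πη)²`, `w` the weight table (`q` odd: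
  `(1/(π(8+|q|)) + 1/(π|8−|q||))²`, `q = ±8`: `¼`, other even `q`: `0`);
* `tsum_lowFibres_sq_norm_phaseOne_le`: `Σ'[|k₁| ≤ 1]‖𝓕a₁‖² ≤ (16/(63π) + 2πη)² + (2πη)²/2` — the `q = ±1` fibres of `a₁`
  (`2·|ĝ₁(1)|² = 2·(16/(63π))² = 0.01307·‖datum‖²` measured, kit j305210), which ARE the start plateau `E_2(K_2)`, `K_2 ∈ [700,1360]`.
No definitions; nothing about the crux at `δ₀ = ¼`. [cite: Grafakos2014, Prop. 3.1.2 (5) and Prop. 3.2.7 (3)] [problem: turb]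
-/

-- `Summit.<Summit>.<Problem>`: single-conjunct summit, the duplicate namespace segment is deliberate.
set_option linter.dupNamespace false

noncomputable section

namespace Summit.AnomalousDissipation.AnomalousDissipation.Theorems.SawtoothPulseCascade.K1Start

open MeasureTheory Set Filter Topology UnitAddTorus Function Complex AddCircle
open scoped Real
open Literature.Analysis Literature.Analysis.FunctionSpaces Literature.Analysis.FunctionSpaces.Torus Literature.Analysis.FluidPDE
open Literature.Analysis.FluidPDE.SawtoothCascade

/-! ## §1 The H half-step of the datum, fibre by fibre -/

/-- **The modes of `b₀ = datum ∘ Φ_H`**: `‖𝓕b₀(k)‖² = ¼‖ĝ_{k₀}(k₁)‖²` if `k₀ = ±1` and `0` otherwise. [cite: Grafakos2014, Prop. 3.1.2 (5)] -/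
theorem sq_norm_mFourierCoeff_datum_comp_shearMap (ψ : ShearProfile) (k : Fin 2 → ℤ) :
    ‖mFourierCoeff (fun x => ((datum ∘ shearMap 0 1 ψ) x : ℂ)) k‖ ^ 2 =
      if k 0 = 1 ∨ k 0 = -1 then 1 / 4 * ‖fourierCoeff (twist ψ (k 0)) (k 1)‖ ^ 2 else 0 := by
  rw [mFourierCoeff_datum_comp_shearMap, mFourierCoeff_datum_single, norm_mul, mul_pow]
  by_cases h1 : k 0 = 1
  · have h2 : k 0 ≠ -1 := by omega
    rw [if_pos (Or.inl h1), if_pos h1, if_neg h2]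
    simp
    ring
  · by_cases h2 : k 0 = -1
    · rw [if_pos (Or.inr h2), if_pos h2, if_neg h1]
      simp
      ring
    · rw [if_neg h1, if_neg h2, if_neg (by tauto)]
      simp

/-- **Weighted V-fibre energies of `b₀`**: for a bounded fibre weight `w(k₁)`,
`Σ' k, w(k₁)‖𝓕b₀(k)‖² = ¼(Σ'_q w(q)‖ĝ₁(q)‖² + Σ'_q w(q)‖ĝ₋₁(q)‖²)`. [cite: Grafakos2014, Prop. 3.2.7 (3)] -/
theorem tsum_fibreWeight_sq_norm_datum_comp_shearMap (ψ : ShearProfile) {w : ℤ → ℝ} {C : ℝ} (hw : ∀ m, |w m| ≤ C) :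
    ∑' k : Fin 2 → ℤ, w (k 1) * ‖mFourierCoeff (fun x => ((datum ∘ shearMap 0 1 ψ) x : ℂ)) k‖ ^ 2 =
      1 / 4 * (∑' q : ℤ, w q * ‖fourierCoeff (twist ψ 1) q‖ ^ 2 + ∑' q : ℤ, w q * ‖fourierCoeff (twist ψ (-1)) q‖ ^ 2) := by
  classical
  set f : (Fin 2 → ℤ) → ℝ := fun k => w (k 1) * ‖mFourierCoeff (fun x => ((datum ∘ shearMap 0 1 ψ) x : ℂ)) k‖ ^ 2 with hf
  -- the two fibre embeddings `q ↦ (±1, q)`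
  set ιp : ℤ → (Fin 2 → ℤ) := fun q => ![1, q] with hιp
  set ιm : ℤ → (Fin 2 → ℤ) := fun q => ![-1, q] with hιm
  have hιp_inj : Injective ιp := fun a b h => by
    have := congr_fun h 1; simpa [hιp] using this
  have hιm_inj : Injective ιm := fun a b h => by
    have := congr_fun h 1; simpa [hιm] using this
  -- summability of the two fibre series (`w` bounded, Parseval)
  have hC : 0 ≤ C := (abs_nonneg _).trans (hw 0)
  have hsum : ∀ c : ℤ, Summable fun q : ℤ => w q * ‖fourierCoeff (twist ψ c) q‖ ^ 2 := fun c => by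
    refine Summable.of_norm_bounded ((hasSum_sq_norm_fourierCoeff_twist ψ c).summable.mul_left C) fun q => ?_
    rw [Real.norm_eq_abs, abs_mul, abs_of_nonneg (sq_nonneg ‖fourierCoeff (twist ψ c) q‖)]
    exact mul_le_mul_of_nonneg_right (hw q) (sq_nonneg _)
  -- `f` splits along the two embeddings
  set fp : (Fin 2 → ℤ) → ℝ := fun k => if k 0 = 1 then f k else 0 with hfp
  set fm : (Fin 2 → ℤ) → ℝ := fun k => if k 0 = -1 then f k else 0 with hfm
  have hsplit : ∀ k, f k = fp k + fm k := by
    intro k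
    simp only [hfp, hfm, hf, sq_norm_mFourierCoeff_datum_comp_shearMap]
    by_cases h1 : k 0 = 1
    · simp [h1]
    · by_cases h2 : k 0 = -1
      · simp [h2]
      · simp [h1, h2]
  have hfp_off : ∀ k ∉ Set.range ιp, fp k = 0 := by
    intro k hk
    simp only [hfp]
    rw [if_neg]
    intro h1
    exact hk ⟨k 1, by ext i; fin_cases i <;> simp [hιp, h1]⟩
  have hfm_off : ∀ k ∉ Set.range ιm, fm k = 0 := by
    intro k hk
    simp only [hfm]
    rw [if_neg]
    intro h1
    exact hk ⟨k 1, by ext i; fin_cases i <;> simp [hιm, h1]⟩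
  have hfp_comp : fp ∘ ιp = fun q => 1 / 4 * (w q * ‖fourierCoeff (twist ψ 1) q‖ ^ 2) := by
    funext q
    have key := sq_norm_mFourierCoeff_datum_comp_shearMap ψ (ιp q)
    have e0 : ιp q 0 = 1 := by simp [hιp]
    have e1 : ιp q 1 = q := by simp [hιp]
    rw [e0, e1, if_pos (Or.inl rfl)] at key
    show fp (ιp q) = _
    simp only [hfp, hf]
    rw [if_pos e0, e1, key]
    ring
  have hfm_comp : fm ∘ ιm = fun q => 1 / 4 * (w q * ‖fourierCoeff (twist ψ (-1)) q‖ ^ 2) := by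
    funext q
    have key := sq_norm_mFourierCoeff_datum_comp_shearMap ψ (ιm q)
    have e0 : ιm q 0 = -1 := by simp [hιm]
    have e1 : ιm q 1 = q := by simp [hιm]
    rw [e0, e1, if_pos (Or.inr rfl)] at key
    show fm (ιm q) = _
    simp only [hfm, hf]
    rw [if_pos e0, e1, key]
    ring
  have hP : HasSum fp (1 / 4 * ∑' q : ℤ, w q * ‖fourierCoeff (twist ψ 1) q‖ ^ 2) := by
    rw [← hιp_inj.hasSum_iff hfp_off, hfp_comp]
    exact ((hsum 1).hasSum).mul_left (1 / 4)
  have hM : HasSum fm (1 / 4 * ∑' q : ℤ, w q * ‖fourierCoeff (twist ψ (-1)) q‖ ^ 2) := by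
    rw [← hιm_inj.hasSum_iff hfm_off, hfm_comp]
    exact ((hsum (-1)).hasSum).mul_left (1 / 4)
  have hF : HasSum f (1 / 4 * ∑' q : ℤ, w q * ‖fourierCoeff (twist ψ 1) q‖ ^ 2 +
      1 / 4 * ∑' q : ℤ, w q * ‖fourierCoeff (twist ψ (-1)) q‖ ^ 2) := by
    have h := hP.add hM
    exact h.congr_fun fun k => (hsplit k)
  rw [hF.tsum_eq]; ring

/-! ## §2 The V-fibre energies of `a₁` -/

/-- **THE V-FIBRE ENERGIES OF `a₁` ARE EXACT**: for `b₀ = datum ∘ Φ_H`, `a₁ = b₀ ∘ Φ_V` (any profile `ψ`) and a bounded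
fibre weight `w(k₁)`, `Σ' k, w(k₁)‖𝓕a₁(k)‖² = ¼(Σ'_q w(q)‖ĝ₁(q)‖² + Σ'_q w(q)‖ĝ₋₁(q)‖²)` — the V half-step is a translation on each
V-fibre (`tsum_verticalWeight_vstep`). [cite: Grafakos2014, Prop. 3.1.2 (5) and Prop. 3.2.7 (3)] -/
theorem tsum_fibreWeight_sq_norm_phaseOne_eq (ψ : ShearProfile) {b a : UnitAddTorus (Fin 2) → ℝ}
    (hb : b = datum ∘ shearMap 0 1 ψ) (ha : a = b ∘ shearMap 1 0 ψ) {w : ℤ → ℝ} {C : ℝ} (hw : ∀ m, |w m| ≤ C) :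
    ∑' k : Fin 2 → ℤ, w (k 1) * ‖mFourierCoeff (fun x => (a x : ℂ)) k‖ ^ 2 =
      1 / 4 * (∑' q : ℤ, w q * ‖fourierCoeff (twist ψ 1) q‖ ^ 2 + ∑' q : ℤ, w q * ‖fourierCoeff (twist ψ (-1)) q‖ ^ 2) := by
  have hbc : Continuous b := by rw [hb]; exact (isSmooth_datum_comp_shearMap ψ).continuous
  rw [tsum_verticalWeight_vstep hbc ψ ha hw, hb]
  exact tsum_fibreWeight_sq_norm_datum_comp_shearMap ψ hw

/-- **One V-fibre of `a₁`**: `Σ' k, [k₁ = q]‖𝓕a₁(k)‖² = ¼(‖ĝ₁(q)‖² + ‖ĝ₋₁(q)‖²)`. [cite: Grafakos2014, Prop. 3.2.7 (3)] -/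
theorem tsum_fibre_sq_norm_phaseOne_eq (ψ : ShearProfile) {b a : UnitAddTorus (Fin 2) → ℝ}
    (hb : b = datum ∘ shearMap 0 1 ψ) (ha : a = b ∘ shearMap 1 0 ψ) (q : ℤ) :
    ∑' k : Fin 2 → ℤ, (if k 1 = q then (1 : ℝ) else 0) * ‖mFourierCoeff (fun x => (a x : ℂ)) k‖ ^ 2 =
      1 / 4 * (‖fourierCoeff (twist ψ 1) q‖ ^ 2 + ‖fourierCoeff (twist ψ (-1)) q‖ ^ 2) := by
  classical
  have hw : ∀ m : ℤ, |(if m = q then (1 : ℝ) else 0)| ≤ 1 := fun m => by split_ifs <;> simp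
  rw [tsum_fibreWeight_sq_norm_phaseOne_eq ψ hb ha hw]
  have h1 : ∀ c : ℤ, ∑' m : ℤ, (if m = q then (1 : ℝ) else 0) * ‖fourierCoeff (twist ψ c) m‖ ^ 2 =
      ‖fourierCoeff (twist ψ c) q‖ ^ 2 := fun c => by
    rw [tsum_eq_single q (fun m hm => by rw [if_neg hm, zero_mul])]
    simp
  rw [h1, h1]

/-! ## §3 Rounding of a single chirp coefficient; the fibre energies at `γ = 8` -/

/-- **Single-coefficient rounding**: if `|n·ψ − λ·tri(2π·)/(2π)| ≤ η` then `‖ĝ_n(q)‖ ≤ ‖ĝ₀(q)‖ + 2πη` for the exact chirp `g₀`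
of frequency `λ` (`sqrt_sum_sq_norm_fourierCoeff_twist_le` on the singleton `{q}`). [cite: Grafakos2014, Prop. 3.2.7 (3)] -/
theorem norm_fourierCoeff_twist_le_of_near (ψ : ShearProfile) (n lam : ℤ) {g₀ : UnitAddCircle → ℂ}
    (hg₀ : ∀ t : ℝ, g₀ (t : UnitAddCircle) = Complex.exp (-(2 * π * I * lam * ((tri (2 * π * t) / (2 * π) : ℝ) : ℂ))))
    (hg₀c : Continuous g₀) {η : ℝ} (hη : ∀ t : ℝ, |n * ψ t - lam * (tri (2 * π * t) / (2 * π))| ≤ η) (q : ℤ) :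
    ‖fourierCoeff (twist ψ n) q‖ ≤ ‖fourierCoeff g₀ q‖ + 2 * π * η := by
  have h := sqrt_sum_sq_norm_fourierCoeff_twist_le ψ n lam hg₀ hg₀c hη {q}
  simpa [Finset.sum_singleton, Real.sqrt_sq (norm_nonneg _)] using h

/-- **THE V-FIBRE ENERGIES OF `a₁` AT `γ = 8`**: with `|ψ − 8·tri(2π·)/(2π)| ≤ η` (rounding) and `w` the exact weight table of
`…ExactChirpSelf` (`m` odd: `(1/(π(8+m)) + 1/(π|8−m|))²`, `m = 8`: `¼`, other even `m`: `0`),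
`Σ'[k₁ = q]‖𝓕a₁‖² ≤ ½(√w(|q|) + 2πη)²` — values of record (×2 = in units of `‖datum‖²`): `q = ±1: .00653`, `±3: .00857`,
`±5: .01705`, `±7: .1153`, `±8: .25`, `±9: .0898`, `±11: .0080`, `±13: .0024`. [cite: Grafakos2014, Prop. 3.2.7 (3)] -/
theorem tsum_fibre_sq_norm_phaseOne_le (ψ : ShearProfile) {b a : UnitAddTorus (Fin 2) → ℝ}
    (hb : b = datum ∘ shearMap 0 1 ψ) (ha : a = b ∘ shearMap 1 0 ψ) {η : ℝ}
    (hη : ∀ t : ℝ, |ψ t - (8 : ℤ) * (tri (2 * π * t) / (2 * π))| ≤ η) (q : ℤ) :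
    ∑' k : Fin 2 → ℤ, (if k 1 = q then (1 : ℝ) else 0) * ‖mFourierCoeff (fun x => (a x : ℂ)) k‖ ^ 2 ≤
      1 / 2 * (Real.sqrt (if Odd q.natAbs then (1 / (π * ((8 : ℝ) + q.natAbs)) + 1 / (π * |(8 : ℝ) - q.natAbs|)) ^ 2
          else if q.natAbs = 8 then (1 / 4 : ℝ) else 0) + 2 * π * η) ^ 2 := by
  rw [tsum_fibre_sq_norm_phaseOne_eq ψ hb ha q]
  set wq : ℝ := (if Odd q.natAbs then (1 / (π * ((8 : ℝ) + q.natAbs)) + 1 / (π * |(8 : ℝ) - q.natAbs|)) ^ 2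
    else if q.natAbs = 8 then (1 / 4 : ℝ) else 0) with hwq
  have hwq0 : 0 ≤ wq := by rw [hwq]; split_ifs <;> positivity
  have hη0 : 0 ≤ η := (abs_nonneg _).trans (hη 0)
  -- the two exact chirps of frequency `±8`
  obtain ⟨gp, hgpc, hgp⟩ := exists_exactChirp 8
  obtain ⟨gm, hgmc, hgm⟩ := exists_exactChirp (-8)
  have hηp : ∀ t : ℝ, |(1 : ℤ) * ψ t - (8 : ℤ) * (tri (2 * π * t) / (2 * π))| ≤ η := fun t => by simpa using hη t
  have hηm : ∀ t : ℝ, |(-1 : ℤ) * ψ t - (-8 : ℤ) * (tri (2 * π * t) / (2 * π))| ≤ η := fun t => by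
    have h := hη t
    rw [show ((-1 : ℤ) : ℝ) * ψ t - ((-8 : ℤ) : ℝ) * (tri (2 * π * t) / (2 * π)) =
      -(ψ t - ((8 : ℤ) : ℝ) * (tri (2 * π * t) / (2 * π))) by push_cast; ring, abs_neg]
    exact h
  have hp := norm_fourierCoeff_twist_le_of_near ψ 1 8 hgp hgpc hηp q
  have hm := norm_fourierCoeff_twist_le_of_near ψ (-1) (-8) hgm hgmc hηm q
  -- exact weights
  have hwp : ‖fourierCoeff gp q‖ ^ 2 ≤ wq :=
    (sq_norm_fourierCoeff_exactChirp_eight_le (Or.inl rfl) hgp hgpc q).trans (by rw [hwq]; exact weightTable_le_natAbs q)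
  have hwm : ‖fourierCoeff gm q‖ ^ 2 ≤ wq :=
    (sq_norm_fourierCoeff_exactChirp_eight_le (Or.inr rfl) hgm hgmc q).trans (by rw [hwq]; exact weightTable_le_natAbs q)
  have hsp : ‖fourierCoeff gp q‖ ≤ Real.sqrt wq := Real.le_sqrt_of_sq_le hwp
  have hsm : ‖fourierCoeff gm q‖ ≤ Real.sqrt wq := Real.le_sqrt_of_sq_le hwm
  have h1 : ‖fourierCoeff (twist ψ 1) q‖ ≤ Real.sqrt wq + 2 * π * η := hp.trans (by linarith)
  have h2 : ‖fourierCoeff (twist ψ (-1)) q‖ ≤ Real.sqrt wq + 2 * π * η := hm.trans (by linarith)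
  have h0 : 0 ≤ Real.sqrt wq + 2 * π * η := by positivity
  have e1 := pow_le_pow_left₀ (norm_nonneg _) h1 2
  have e2 := pow_le_pow_left₀ (norm_nonneg _) h2 2
  linarith

/-- **THE LOW V-FIBRES OF `a₁` AT `γ = 8`** (the start plateau): `Σ'[|k₁| ≤ 1]‖𝓕a₁‖² ≤ (16/(63π) + 2πη)² + (2πη)²/2`
(`q = 0`: the exact weight vanishes; `q = ±1`: `1/(9π) + 1/(7π) = 16/(63π)`). [cite: Grafakos2014, Prop. 3.2.7 (3)] -/
theorem tsum_lowFibres_sq_norm_phaseOne_le (ψ : ShearProfile) {b a : UnitAddTorus (Fin 2) → ℝ}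
    (hb : b = datum ∘ shearMap 0 1 ψ) (ha : a = b ∘ shearMap 1 0 ψ) {η : ℝ}
    (hη : ∀ t : ℝ, |ψ t - (8 : ℤ) * (tri (2 * π * t) / (2 * π))| ≤ η) :
    ∑' k : Fin 2 → ℤ, (if |k 1| ≤ 1 then (1 : ℝ) else 0) * ‖mFourierCoeff (fun x => (a x : ℂ)) k‖ ^ 2 ≤
      (16 / (63 * π) + 2 * π * η) ^ 2 + (2 * π * η) ^ 2 / 2 := by
  classical
  have hπ : 0 < π := Real.pi_pos
  have hη0 : 0 ≤ η := (abs_nonneg _).trans (hη 0)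
  -- `[|k₁| ≤ 1] = [k₁ = -1] + [k₁ = 0] + [k₁ = 1]`
  have hind : ∀ k : Fin 2 → ℤ, (if |k 1| ≤ 1 then (1 : ℝ) else 0) =
      (if k 1 = -1 then (1 : ℝ) else 0) + (if k 1 = 0 then (1 : ℝ) else 0) + (if k 1 = 1 then (1 : ℝ) else 0) := by
    intro k
    by_cases h : |k 1| ≤ 1
    · rw [if_pos h]
      rcases (abs_le.mp h) with ⟨h1, h2⟩
      interval_cases (k 1) <;> simp
    · rw [if_neg h]
      have h1 : k 1 ≠ -1 := fun e => h (by rw [e]; simp)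
      have h2 : k 1 ≠ 0 := fun e => h (by rw [e]; simp)
      have h3 : k 1 ≠ 1 := fun e => h (by rw [e]; simp)
      simp [h1, h2, h3]
  -- summability of each fibre term
  have hac : Continuous fun x => (a x : ℂ) := by
    rw [ha, hb]
    exact Complex.continuous_ofReal.comp
      ((isSmooth_datum_comp_shearMap ψ).continuous.comp (continuous_shearMap 1 0 ψ))
  set c : (Fin 2 → ℤ) → ℝ := fun k => ‖mFourierCoeff (fun x => (a x : ℂ)) k‖ ^ 2 with hc
  have hcs : Summable c := (hasSum_sq_mFourierCoeff_of_continuous hac).summable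
  have hI : ∀ q : ℤ, Summable fun k : Fin 2 → ℤ => (if k 1 = q then (1 : ℝ) else 0) * c k := fun q =>
    Summable.of_nonneg_of_le (fun k => mul_nonneg (by split_ifs <;> norm_num) (sq_nonneg _))
      (fun k => mul_le_of_le_one_left (sq_nonneg _) (by split_ifs <;> norm_num)) hcs
  have hsplit : ∑' k : Fin 2 → ℤ, (if |k 1| ≤ 1 then (1 : ℝ) else 0) * c k =
      ∑' k, (if k 1 = -1 then (1 : ℝ) else 0) * c k + ∑' k, (if k 1 = 0 then (1 : ℝ) else 0) * c k +
        ∑' k, (if k 1 = 1 then (1 : ℝ) else 0) * c k := by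
    rw [← (hI (-1)).tsum_add (hI 0), ← ((hI (-1)).add (hI 0)).tsum_add (hI 1)]
    exact tsum_congr fun k => by rw [hind k]; ring
  rw [hsplit]
  have hm1 := tsum_fibre_sq_norm_phaseOne_le ψ hb ha hη (-1)
  have h0 := tsum_fibre_sq_norm_phaseOne_le ψ hb ha hη 0
  have hp1 := tsum_fibre_sq_norm_phaseOne_le ψ hb ha hη 1
  -- the weights: `|±1| = 1` odd with `1/(9π) + 1/(7π) = 16/(63π)`; `0` even, `≠ 8`
  have e1 : (1 : ℤ).natAbs = 1 := rfl
  have em1 : (-1 : ℤ).natAbs = 1 := rfl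
  have e0 : (0 : ℤ).natAbs = 0 := rfl
  have hodd1 : Odd (1 : ℕ) := odd_one
  have hev0 : ¬ Odd (0 : ℕ) := by decide
  simp only [e1, em1, e0, if_pos hodd1, if_neg hev0, Nat.cast_one, Nat.cast_zero, show (0 : ℕ) ≠ 8 by decide,
    if_false] at hm1 h0 hp1
  have hw1 : (1 / (π * ((8 : ℝ) + 1)) + 1 / (π * |(8 : ℝ) - 1|)) ^ 2 = (16 / (63 * π)) ^ 2 := by
    rw [show |(8 : ℝ) - 1| = 7 by norm_num]
    field_simp
    ring
  rw [hw1, Real.sqrt_sq (by positivity)] at hm1 hp1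
  rw [Real.sqrt_zero, zero_add] at h0
  linarith

end Summit.AnomalousDissipation.AnomalousDissipation.Theorems.SawtoothPulseCascade.K1Start
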